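import Summits.RiemannHypothesis.RiemannHypothesis.Theorems.WeilGroundStateGroundStatesConvergeToXiStubDoobPrime
import Summits.RiemannHypothesis.RiemannHypothesis.Theorems.WeilGroundStateGroundStatesConvergeToXiStubPsiDecay
import Summits.RiemannHypothesis.RiemannHypothesis.Theorems.WeilGroundStateGroundStatesConvergeToXiStubMellinXi
import Literature.NumberTheory.LFunctions.WeilExplicit
import Literature.NumberTheory.LFunctions.WeilMarkovQuadratic
import Literature.NumberTheory.LFunctions.RiemannXi
import Literature.Analysis.Complex.PolyaBesselKernel
import HarnessLib

/-!
# `WeilGroundState.GroundStatesConvergeToXi` — the pole form of `Φw` through jump energies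
(crux item stmt-RiemannHypothesis-1527, route route-RiemannHypothesis-WeilGroundState; line `Sketch`,
stub `stub_doob_polar` (D3); `--supports`)

Dictionary (inline, no definitions): `Φ(t) = 2Ψ(2t)` is Riemann's kernel (real form
`2 * LagariasMontague.Psi (2 * t)`, complex form `(2 : ℂ) * LagariasMontague.Psic (2 * t)`); for a
test function `w`, `u = Φ·w`, `k = u ⋆ ũ`, `g_w = Φ‖w‖²`,
`I_w(h) = ∫ Φ(t)Φ(t+h)‖w(t+h) − w(t)‖² dt`, `C = cosh(·/2)`, `S = sinh(·/2)`,
`P(u) = 2|∫ u C|² − 2|∫ u S|²` (`weilPoleForm`).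

* MOMENTS (`doobPol_moments`): `Φ̂ = ξ` (`stub_mellinXi`) at `s = 1, 0` and `ξ(1) = ξ(0) = 1/2` give
  `∫ Φ e^{±t/2} = 1/2`, hence `∫ Φ C = 1/2`, `∫ Φ S = 0`.
* IDENTITY (`doobPol_main`, for a general weight `φ` with `|φ(t + x)| ≤ K e^{|x|} e^{−|t|}`):
  `I_w(h) = ⟨g_w, φ(h+·) + φ(−h+·)⟩ − (k(h) + k(−h))` (`doobP_increment`,
  `weilConv_weilReflect_add_neg`); the `k`-piece integrates against `2C` over `(0, ∞)` to
  `∫_ℝ 2Ck = k̂(0) + k̂(1) = weilPolarTerm k`, of value `P(u)`; the `g_w`-piece by Fubini on `ℝ × ℝ`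
  (`doobPol_integrable_prod`, majorant `2K e^{A} e^{−|h|/2}|g_w(x)|` on the support `|x| ≤ A`
  of `w`) and `∫ C(h)φ(h + x) dh = C(x)∫φC − S(x)∫φS` (`Real.cosh_sub`), whence
  `∫₀^∞ 2C I_w = 2(∫φC)∫g_wC − 2(∫φS)∫g_wS − P(u)`, `= ∫ g_w C − P(Φw)` for `φ = Φ`.

No new definitions; no named fact is used.
-/

noncomputable section

set_option linter.dupNamespace false

open scoped Topology Real ComplexConjugate
open Filter Set MeasureTheory Complex

namespace Summit.RiemannHypothesis.RiemannHypothesis.Theorems.GroundStatesConvergeToXi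

open Literature.NumberTheory.LFunctions

/-! ## Integrability helpers (`cosh x ≤ e^{|x|}`, `|sinh x| ≤ e^{|x|}` are
`DeBruijn1950.cosh_le_exp_abs`, `Polya1926.abs_sinh_le_exp_abs`) -/

/-- A continuous `φ` with `|φ(t)| ≤ K e^{-|t|}` times a continuous `m` with `|m(t)| ≤ e^{|t|/2}` is
integrable (majorant `K e^{-|t|/2}`). [folklore] -/
theorem doobPol_integrable_decay {φ m : ℝ → ℝ} (hφc : Continuous φ) {K : ℝ}
    (hKe : ∀ t, |φ t| ≤ K * Real.exp (-|t|)) (hm : Continuous m)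
    (hmb : ∀ t, |m t| ≤ Real.exp (|t| / 2)) : Integrable fun t => φ t * m t := by
  refine ((Literature.Analysis.Complex.integrable_exp_neg_mul_abs
    (by norm_num : (0 : ℝ) < 1 / 2)).const_mul K).mono' (hφc.mul hm).aestronglyMeasurable
    (ae_of_all _ fun t => ?_)
  rw [Real.norm_eq_abs, abs_mul]
  calc |φ t| * |m t| ≤ K * Real.exp (-|t|) * Real.exp (|t| / 2) :=
        mul_le_mul (hKe t) (hmb t) (abs_nonneg _) ((abs_nonneg _).trans (hKe t))
    _ = K * Real.exp (-(1 / 2) * |t|) := by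
        rw [mul_assoc, ← Real.exp_add, show -|t| + |t| / 2 = -(1 / 2) * |t| by ring]

/-- `g_w · m = φ ‖w‖² m` is integrable for continuous `φ, m` and a test function `w`
(continuous with compact support). [folklore] -/
theorem doobPol_integrable_gmul {φ : ℝ → ℝ} (hφc : Continuous φ) {w : ℝ → ℂ} (hw : IsWeilTest w)
    {m : ℝ → ℝ} (hm : Continuous m) : Integrable fun x : ℝ => φ x * ‖w x‖ ^ 2 * m x := by
  have hwc : Continuous w := hw.1.continuous
  refine Continuous.integrable_of_hasCompactSupport (by fun_prop) ?_
  obtain ⟨A, hA⟩ := hw.2.isCompact.isBounded.subset_closedBall 0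
  refine HasCompactSupport.intro (isCompact_closedBall (0 : ℝ) A) fun x hx => ?_
  have hw0 : w x = 0 := not_not.1 fun hne => hx (hA (subset_tsupport _ hne))
  simp [hw0]

/-- `∫₀^∞ (f(h) + f(−h)) dh = ∫_ℝ f` for an integrable `f`. [folklore] -/
theorem doobPol_integral_Ioi_add_neg {E : Type*} [NormedAddCommGroup E] [NormedSpace ℝ E]
    {f : ℝ → E} (hf : Integrable f) :
    ∫ h in Ioi (0 : ℝ), (f h + f (-h)) = ∫ h, f h := by
  rw [integral_add hf.integrableOn hf.comp_neg.integrableOn, integral_comp_neg_Ioi 0 f, neg_zero,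
    ← compl_Ioi, integral_add_compl measurableSet_Ioi hf]

/-! ## Joint integrability for the `g`-piece -/

/-- **Joint integrability** of `(h, x) ↦ 2cosh(h/2) φ(x)‖w x‖² φ(h + x)` on `ℝ × ℝ`: on the support
`|x| ≤ A` of `w`, `|φ(h + x)| ≤ K e^{A} e^{-|h|}` and `cosh(h/2) ≤ e^{|h|/2}`, so the integrand is
dominated by `2K e^{A} e^{-|h|/2} · |φ(x)|‖w x‖²` (with `g = φ‖w‖²` integrable). [folklore] -/
theorem doobPol_integrable_prod {φ : ℝ → ℝ} (hφc : Continuous φ) {K : ℝ} (hK0 : 0 ≤ K)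
    (hφb : ∀ t x : ℝ, |φ (t + x)| ≤ K * Real.exp |x| * Real.exp (-|t|))
    {w : ℝ → ℂ} (hw : IsWeilTest w) (hg : Integrable fun x : ℝ => φ x * ‖w x‖ ^ 2) :
    Integrable (fun z : ℝ × ℝ => 2 * Real.cosh (z.1 / 2) * (φ z.2 * ‖w z.2‖ ^ 2 * φ (z.1 + z.2)))
      ((volume : Measure ℝ).prod volume) := by
  have hwc : Continuous w := hw.1.continuous
  obtain ⟨A, hA⟩ := hw.2.isCompact.isBounded.subset_closedBall 0
  have hwA : ∀ x, w x ≠ 0 → |x| ≤ A := fun x hx => by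
    have h := hA (subset_tsupport _ hx)
    rwa [Metric.mem_closedBall, dist_zero_right, Real.norm_eq_abs] at h
  have hdom : Integrable (fun z : ℝ × ℝ => 2 * K * Real.exp A * Real.exp (-(1 / 2) * |z.1|) *
      ‖φ z.2 * ‖w z.2‖ ^ 2‖) ((volume : Measure ℝ).prod volume) :=
    ((Literature.Analysis.Complex.integrable_exp_neg_mul_abs
      (by norm_num : (0 : ℝ) < 1 / 2)).const_mul (2 * K * Real.exp A)).mul_prod hg.norm
  refine hdom.mono' (by fun_prop : Continuous fun z : ℝ × ℝ =>
      2 * Real.cosh (z.1 / 2) * (φ z.2 * ‖w z.2‖ ^ 2 * φ (z.1 + z.2))).aestronglyMeasurable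
    (ae_of_all _ fun z => ?_)
  simp only [Real.norm_eq_abs]
  by_cases hz : w z.2 = 0
  · simp [hz]
  · have hx : |z.2| ≤ A := hwA z.2 hz
    have h1 : |φ (z.1 + z.2)| ≤ K * Real.exp A * Real.exp (-|z.1|) :=
      (hφb z.1 z.2).trans (by gcongr)
    have h2 : Real.cosh (z.1 / 2) ≤ Real.exp (|z.1| / 2) := by
      simpa only [abs_div, abs_two] using
        Literature.Analysis.Complex.DeBruijn1950.cosh_le_exp_abs (z.1 / 2)
    have h3 : Real.exp (|z.1| / 2) * Real.exp (-|z.1|) = Real.exp (-(1 / 2) * |z.1|) := by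
      rw [← Real.exp_add, show |z.1| / 2 + -|z.1| = -(1 / 2) * |z.1| by ring]
    have hc0 : 0 < Real.cosh (z.1 / 2) := Real.cosh_pos _
    have e : |2 * Real.cosh (z.1 / 2) * (φ z.2 * ‖w z.2‖ ^ 2 * φ (z.1 + z.2))| =
        2 * Real.cosh (z.1 / 2) * |φ (z.1 + z.2)| * |φ z.2 * ‖w z.2‖ ^ 2| := by
      rw [abs_mul, abs_mul (φ z.2 * ‖w z.2‖ ^ 2), abs_mul (2 : ℝ), abs_two, abs_of_pos hc0]
      ring
    rw [e]
    have h4 : 2 * Real.cosh (z.1 / 2) * |φ (z.1 + z.2)| ≤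
        2 * K * Real.exp A * Real.exp (-(1 / 2) * |z.1|) := by
      calc 2 * Real.cosh (z.1 / 2) * |φ (z.1 + z.2)|
          ≤ 2 * Real.exp (|z.1| / 2) * (K * Real.exp A * Real.exp (-|z.1|)) := by gcongr
        _ = 2 * K * Real.exp A * (Real.exp (|z.1| / 2) * Real.exp (-|z.1|)) := by ring
        _ = 2 * K * Real.exp A * Real.exp (-(1 / 2) * |z.1|) := by rw [h3]
    exact mul_le_mul_of_nonneg_right h4 (abs_nonneg _)

/-! ## The Doob polar identity for a general weight -/

/-- **The Doob polar identity for a general weight.**  For a continuous real `φ` with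
`|φ(t + x)| ≤ K e^{|x|} e^{-|t|}`, moments `c₁ = ∫ φ(s) cosh(s/2) ds`, `c₂ = ∫ φ(s) sinh(s/2) ds`,
a test function `w` and a test function `u = φ·w`, with `g = φ‖w‖²` and
`I(h) = ∫ φ(t)φ(t+h)‖w(t+h) − w(t)‖² dt`: `h ↦ cosh(h/2) I(h)` is integrable on `ℝ` and
`∫₀^∞ 2cosh(h/2) I(h) dh = 2c₁ ∫ g cosh(x/2) − 2c₂ ∫ g sinh(x/2) − weilPoleForm u` (`k`-piece:
`k̂(0) + k̂(1) = weilPolarTerm (u ⋆ ũ)` equals `weilPoleForm u`; `g`-piece: Fubini). [folklore] -/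
theorem doobPol_main {φ : ℝ → ℝ} (hφc : Continuous φ) {K : ℝ} (hK0 : 0 ≤ K)
    (hφb : ∀ t x : ℝ, |φ (t + x)| ≤ K * Real.exp |x| * Real.exp (-|t|))
    {c₁ c₂ : ℝ} (hc₁ : ∫ s : ℝ, φ s * Real.cosh (s / 2) = c₁)
    (hc₂ : ∫ s : ℝ, φ s * Real.sinh (s / 2) = c₂)
    {w u : ℝ → ℂ} (hw : IsWeilTest w) (huT : IsWeilTest u) (hu : ∀ t, u t = (φ t : ℂ) * w t) :
    Integrable (fun h : ℝ => Real.cosh (h / 2) *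
        ∫ t : ℝ, φ t * φ (t + h) * ‖w (t + h) - w t‖ ^ 2) ∧
    (∫ h in Ioi (0 : ℝ), 2 * Real.cosh (h / 2) *
        ∫ t : ℝ, φ t * φ (t + h) * ‖w (t + h) - w t‖ ^ 2) =
      2 * c₁ * (∫ x : ℝ, φ x * ‖w x‖ ^ 2 * Real.cosh (x / 2)) -
        2 * c₂ * (∫ x : ℝ, φ x * ‖w x‖ ^ 2 * Real.sinh (x / 2)) - weilPoleForm u := by
  -- bounds on `φ`
  have hKe : ∀ t, |φ t| ≤ K * Real.exp (-|t|) := fun t => by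
    simpa only [add_zero, abs_zero, Real.exp_zero, mul_one] using hφb t 0
  have hK : ∀ t, |φ t| ≤ K := fun t => (hKe t).trans
    (mul_le_of_le_one_right hK0 (Real.exp_le_one_iff.mpr (neg_nonpos.mpr (abs_nonneg t))))
  have hwc : Continuous w := hw.1.continuous
  -- integrable pieces
  have hg : Integrable fun x : ℝ => φ x * ‖w x‖ ^ 2 :=
    doobP_integrable_mul hφc hK hw.integrable_norm_sq
  have hgC : Integrable fun x : ℝ => φ x * ‖w x‖ ^ 2 * Real.cosh (x / 2) :=
    doobPol_integrable_gmul hφc hw (by fun_prop)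
  have hgS : Integrable fun x : ℝ => φ x * ‖w x‖ ^ 2 * Real.sinh (x / 2) :=
    doobPol_integrable_gmul hφc hw (by fun_prop)
  have hφC : Integrable fun s : ℝ => φ s * Real.cosh (s / 2) :=
    doobPol_integrable_decay hφc hKe (by fun_prop) fun t => by
      simpa only [abs_of_pos (Real.cosh_pos _), abs_div, abs_two] using
        Literature.Analysis.Complex.DeBruijn1950.cosh_le_exp_abs (t / 2)
  have hφS : Integrable fun s : ℝ => φ s * Real.sinh (s / 2) :=
    doobPol_integrable_decay hφc hKe (by fun_prop) fun t => by
      simpa only [abs_div, abs_two] using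
        Literature.Analysis.Complex.Polya1926.abs_sinh_le_exp_abs (t / 2)
  -- the pieces `J` (the `g`-piece) and `R` (the `k`-piece), kept opaque
  obtain ⟨J, hJ⟩ : ∃ J : ℝ → ℝ, J = fun h =>
      ∫ x : ℝ, φ x * ‖w x‖ ^ 2 * (φ (h + x) + φ (-h + x)) := ⟨_, rfl⟩
  obtain ⟨R, hR⟩ : ∃ R : ℝ → ℝ, R = fun h =>
      2 * (∫ x : ℝ, ‖u x‖ ^ 2) - weilIncrement u h := ⟨_, rfl⟩
  have hIJR : ∀ h : ℝ, (∫ t : ℝ, φ t * φ (t + h) * ‖w (t + h) - w t‖ ^ 2) = J h - R h := by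
    intro h
    have e := doobP_increment hφc hK hw hu h
    simp only [hJ, hR]
    linarith
  -- ### the `k`-piece
  have hkT : IsWeilTest (weilConv u (weilReflect u)) := huT.weilConv huT.weilReflect
  have hRC : ∀ h : ℝ, (R h : ℂ) =
      weilConv u (weilReflect u) h + weilConv u (weilReflect u) (-h) := fun h => by
    rw [hR, weilConv_weilReflect_add_neg huT h]
  have hRre : ∀ h : ℝ, R h = 2 * (weilConv u (weilReflect u) h).re := fun h => by
    have e := congrArg Complex.re (hRC h)
    rw [Complex.ofReal_re, Complex.add_re, weilConv_weilReflect_neg, Complex.conj_re] at e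
    linarith
  have hG : Integrable fun h : ℝ => weilConv u (weilReflect u) h * (Real.cosh (h / 2) : ℂ) :=
    hkT.integrable_mul (by fun_prop)
  have hRint : Integrable fun h : ℝ => Real.cosh (h / 2) * R h := by
    refine (hG.re.const_mul 2).congr (ae_of_all _ fun h => ?_)
    beta_reduce
    rw [RCLike.re_to_complex, Complex.re_mul_ofReal, hRre h]
    ring
  have hpole : ((weilPoleForm u : ℝ) : ℂ) =
      2 * ∫ h : ℝ, weilConv u (weilReflect u) h * (Real.cosh (h / 2) : ℂ) := by
    rw [← two_mul_re_weilMellin_zero_mul_conj_one huT, ← weilPolarTerm_weilConv_weilReflect huT,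
      weilPolarTerm, weilMellin_zero_eq_cosh_sub_sinh hkT, weilMellin_one_eq_cosh_add_sinh hkT]
    ring
  have hRval : (∫ h in Ioi (0 : ℝ), 2 * Real.cosh (h / 2) * R h) = weilPoleForm u := by
    have e : ((∫ h in Ioi (0 : ℝ), 2 * Real.cosh (h / 2) * R h : ℝ) : ℂ) =
        ∫ h in Ioi (0 : ℝ), (2 * (weilConv u (weilReflect u) h * (Real.cosh (h / 2) : ℂ)) +
          2 * (weilConv u (weilReflect u) (-h) * (Real.cosh (-h / 2) : ℂ))) := by
      rw [← integral_complex_ofReal]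
      refine integral_congr_ae (ae_of_all _ fun h => ?_)
      beta_reduce
      rw [Complex.ofReal_mul, hRC h, neg_div, Real.cosh_neg]
      push_cast
      ring
    rw [doobPol_integral_Ioi_add_neg
        (f := fun h : ℝ => 2 * (weilConv u (weilReflect u) h * (Real.cosh (h / 2) : ℂ)))
        (hG.const_mul 2), integral_const_mul, ← hpole] at e
    exact_mod_cast e
  -- ### the `g`-piece: Fubini for `F h x = 2cosh(h/2) g(x) φ(h + x)`
  obtain ⟨F, hF⟩ : ∃ F : ℝ → ℝ → ℝ, F = fun h x =>
      2 * Real.cosh (h / 2) * (φ x * ‖w x‖ ^ 2 * φ (h + x)) := ⟨_, rfl⟩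
  have hFi : Integrable (Function.uncurry F) ((volume : Measure ℝ).prod volume) := by
    rw [hF]
    exact doobPol_integrable_prod hφc hK0 hφb hw hg
  have hf : Integrable (fun h : ℝ => ∫ x : ℝ, F h x) := hFi.integral_prod_left
  have hswap : ∫ h : ℝ, ∫ x : ℝ, F h x = ∫ x : ℝ, ∫ h : ℝ, F h x := integral_integral_swap hFi
  have hf_apply : ∀ h : ℝ, (∫ x : ℝ, F h x) =
      2 * Real.cosh (h / 2) * ∫ x : ℝ, φ x * ‖w x‖ ^ 2 * φ (h + x) := fun h => by
    rw [hF]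
    exact integral_const_mul _ _
  have hJf : ∀ h : ℝ, 2 * Real.cosh (h / 2) * J h = (∫ x : ℝ, F h x) + ∫ x : ℝ, F (-h) x := by
    intro h
    have i1 : Integrable fun x : ℝ => φ x * ‖w x‖ ^ 2 * φ (h + x) :=
      doobP_integrable_mul' hg (by fun_prop) fun x => hK _
    have i2 : Integrable fun x : ℝ => φ x * ‖w x‖ ^ 2 * φ (-h + x) :=
      doobP_integrable_mul' hg (by fun_prop) fun x => hK _
    rw [hf_apply, hf_apply, neg_div, Real.cosh_neg, hJ]
    beta_reduce
    simp_rw [mul_add]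
    rw [integral_add i1 i2]
    ring
  have hJint : Integrable fun h : ℝ => Real.cosh (h / 2) * J h := by
    have h2 : Integrable (fun h : ℝ => (1 / 2 : ℝ) * ((∫ x : ℝ, F h x) + ∫ x : ℝ, F (-h) x)) :=
      (hf.add hf.comp_neg).const_mul (1 / 2 : ℝ)
    refine h2.congr (ae_of_all _ fun h => ?_)
    beta_reduce
    rw [← hJf h]
    ring
  have hinner : ∀ x : ℝ, (∫ h : ℝ, F h x) =
      2 * c₁ * (φ x * ‖w x‖ ^ 2 * Real.cosh (x / 2)) -
        2 * c₂ * (φ x * ‖w x‖ ^ 2 * Real.sinh (x / 2)) := by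
    intro x
    have e := integral_add_right_eq_self (μ := volume)
      (fun s : ℝ => Real.cosh ((s - x) / 2) * φ s) x
    simp only [add_sub_cancel_right] at e
    have e2 : (∫ s : ℝ, Real.cosh ((s - x) / 2) * φ s) =
        Real.cosh (x / 2) * c₁ - Real.sinh (x / 2) * c₂ := by
      have hpt : ∀ s : ℝ, Real.cosh ((s - x) / 2) * φ s =
          Real.cosh (x / 2) * (φ s * Real.cosh (s / 2)) -
            Real.sinh (x / 2) * (φ s * Real.sinh (s / 2)) := by
        intro s
        rw [sub_div, Real.cosh_sub]
        ring
      simp_rw [hpt]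
      rw [integral_sub (hφC.const_mul _) (hφS.const_mul _), integral_const_mul,
        integral_const_mul, hc₁, hc₂]
    have e3 : (∫ h : ℝ, F h x) =
        2 * (φ x * ‖w x‖ ^ 2) * ∫ h : ℝ, Real.cosh (h / 2) * φ (h + x) := by
      rw [hF, ← integral_const_mul]
      refine integral_congr_ae (ae_of_all _ fun h => ?_)
      beta_reduce
      ring
    rw [e3, e, e2]
    ring
  have hJval : (∫ h in Ioi (0 : ℝ), 2 * Real.cosh (h / 2) * J h) =
      2 * c₁ * (∫ x : ℝ, φ x * ‖w x‖ ^ 2 * Real.cosh (x / 2)) -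
        2 * c₂ * (∫ x : ℝ, φ x * ‖w x‖ ^ 2 * Real.sinh (x / 2)) := by
    have e1 : (∫ h in Ioi (0 : ℝ), 2 * Real.cosh (h / 2) * J h) =
        ∫ h in Ioi (0 : ℝ), ((∫ x : ℝ, F h x) + ∫ x : ℝ, F (-h) x) :=
      setIntegral_congr_fun measurableSet_Ioi fun h _ => hJf h
    rw [e1, doobPol_integral_Ioi_add_neg (f := fun h : ℝ => ∫ x : ℝ, F h x) hf, hswap,
      integral_congr_ae (ae_of_all _ hinner), integral_sub (hgC.const_mul _) (hgS.const_mul _),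
      integral_const_mul, integral_const_mul]
  -- ### assembly
  refine ⟨(hJint.sub hRint).congr (ae_of_all _ fun h => ?_), ?_⟩
  · simp only [Pi.sub_apply]
    rw [hIJR h]
    ring
  · have iJ : Integrable fun h : ℝ => 2 * Real.cosh (h / 2) * J h := by
      simpa only [mul_assoc] using hJint.const_mul 2
    have iR : Integrable fun h : ℝ => 2 * Real.cosh (h / 2) * R h := by
      simpa only [mul_assoc] using hRint.const_mul 2
    have e1 : (∫ h in Ioi (0 : ℝ), 2 * Real.cosh (h / 2) *
        ∫ t : ℝ, φ t * φ (t + h) * ‖w (t + h) - w t‖ ^ 2) =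
        ∫ h in Ioi (0 : ℝ), (2 * Real.cosh (h / 2) * J h - 2 * Real.cosh (h / 2) * R h) :=
      setIntegral_congr_fun measurableSet_Ioi fun h _ => by rw [hIJR h]; ring
    rw [e1, integral_sub iJ.integrableOn iR.integrableOn, hJval, hRval]

/-! ## Specialisation to Riemann's kernel `Φ(t) = 2Ψ(2t)` -/

/-- **Moments of Riemann's kernel**: `∫ Φ(t) e^{t/2} dt = ξ(1) = 1/2`,
`∫ Φ(t) e^{-t/2} dt = ξ(0) = 1/2` (`Φ̂ = ξ`, `stub_mellinXi`), hence `∫ Φ(t) cosh(t/2) dt = 1/2` and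
`∫ Φ(t) sinh(t/2) dt = 0` (`|Φ(t)| ≤ K e^{-|t|}`, `doobP_exists_bound` at `x = 0`, makes
`Φ e^{±t/2}` integrable). [folklore] -/
theorem doobPol_moments :
    (∫ t : ℝ, 2 * LagariasMontague.Psi (2 * t) * Real.cosh (t / 2) = 1 / 2) ∧
    (∫ t : ℝ, 2 * LagariasMontague.Psi (2 * t) * Real.sinh (t / 2) = 0) := by
  -- the exponential moments through `Φ̂ = ξ`
  have hM := stub_mellinXi stub_psiDecay.1 stub_psiDecay.2
  have key : ∀ (s : ℂ) (r : ℝ → ℝ),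
      (∀ t : ℝ, cexp ((s - 1 / 2) * t) = ((Real.exp (r t) : ℝ) : ℂ)) →
      ((∫ t : ℝ, 2 * LagariasMontague.Psi (2 * t) * Real.exp (r t) : ℝ) : ℂ) = riemannXi s := by
    intro s r hr
    rw [← hM s]
    simp only [weilMellin, ← integral_complex_ofReal]
    refine integral_congr_ae (ae_of_all _ fun t => ?_)
    beta_reduce
    rw [hr t, doobP_phic]; push_cast; ring
  have h1 : (∫ t : ℝ, 2 * LagariasMontague.Psi (2 * t) * Real.exp (t / 2)) = 1 / 2 := by
    have h := key 1 (fun t => t / 2) (fun t => by push_cast; congr 1; ring)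
    rw [riemannXi_one] at h
    exact Complex.ofReal_injective (h.trans (by norm_num))
  have h0 : (∫ t : ℝ, 2 * LagariasMontague.Psi (2 * t) * Real.exp (-(t / 2))) = 1 / 2 := by
    have h := key 0 (fun t => -(t / 2)) (fun t => by push_cast; congr 1; ring)
    rw [riemannXi_zero] at h
    exact Complex.ofReal_injective (h.trans (by norm_num))
  -- integrability of `Φ e^{±t/2}`
  obtain ⟨K, -, hKb⟩ := doobP_exists_bound
  have hKe : ∀ t : ℝ, |2 * LagariasMontague.Psi (2 * t)| ≤ K * Real.exp (-|t|) := fun t => by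
    simpa only [add_zero, abs_zero, Real.exp_zero, mul_one] using hKb t 0
  have hφc : Continuous fun t : ℝ => 2 * LagariasMontague.Psi (2 * t) :=
    continuous_const.mul ((LagariasMontague.continuous_thetaSeries _).comp
      (continuous_const.mul continuous_id))
  have i1 : Integrable fun t : ℝ => 2 * LagariasMontague.Psi (2 * t) * Real.exp (t / 2) :=
    doobPol_integrable_decay hφc hKe (by fun_prop) fun t => by
      rw [Real.abs_exp]; exact Real.exp_le_exp.2 (by linarith [le_abs_self t])
  have i0 : Integrable fun t : ℝ => 2 * LagariasMontague.Psi (2 * t) * Real.exp (-(t / 2)) :=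
    doobPol_integrable_decay hφc hKe (by fun_prop) fun t => by
      rw [Real.abs_exp]; exact Real.exp_le_exp.2 (by linarith [neg_le_abs t])
  constructor
  · have e : (fun t : ℝ => 2 * LagariasMontague.Psi (2 * t) * Real.cosh (t / 2)) = fun t =>
        (1 / 2 : ℝ) * (2 * LagariasMontague.Psi (2 * t) * Real.exp (t / 2)) +
          (1 / 2 : ℝ) * (2 * LagariasMontague.Psi (2 * t) * Real.exp (-(t / 2))) := by
      funext t; rw [Real.cosh_eq]; ring
    rw [e, integral_add (i1.const_mul _) (i0.const_mul _), integral_const_mul, integral_const_mul,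
      h1, h0]
    norm_num
  · have e : (fun t : ℝ => 2 * LagariasMontague.Psi (2 * t) * Real.sinh (t / 2)) = fun t =>
        (1 / 2 : ℝ) * (2 * LagariasMontague.Psi (2 * t) * Real.exp (t / 2)) -
          (1 / 2 : ℝ) * (2 * LagariasMontague.Psi (2 * t) * Real.exp (-(t / 2))) := by
      funext t; rw [Real.sinh_eq]; ring
    rw [e, integral_sub (i1.const_mul _) (i0.const_mul _), integral_const_mul, integral_const_mul,
      h1, h0]
    norm_num

/-- **Stub D3 — `doob_polar` (RH-free).**  For Riemann's kernel `Φ = 2Ψ(2·)`: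
`∫ Φ(t) cosh(t/2) dt = 1/2`, `∫ Φ(t) sinh(t/2) dt = 0` (`Φ̂ = ξ` at `s = 1, 0`, `ξ(1) = ξ(0) = 1/2`)
and, for every test function `w`, with `g_w = Φ‖w‖²` and the `Φ`-weighted jump energy
`I_w(h) = ∫ Φ(t)Φ(t+h)‖w(t+h) − w(t)‖² dt`: `h ↦ cosh(h/2) I_w(h)` is integrable on `ℝ` and
`P(Φw) − ∫ g_w(x) cosh(x/2) dx = −∫₀^∞ 2cosh(h/2) I_w(h) dh` (Doob transform:
`I_w(h) = ⟨g_w, Φ(h+·) + Φ(−h+·)⟩ − (k(h) + k(−h))`, `k = (Φw) ⋆ (Φw)~`; the `k`-piece gives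
`k̂(0) + k̂(1) = P(Φw)`, the `g_w`-piece `∫ g_w cosh(x/2)` by Fubini and the moments). [folklore] -/
theorem stub_doob_polar :
    (∫ t : ℝ, 2 * LagariasMontague.Psi (2 * t) * Real.cosh (t / 2) = 1 / 2) ∧
    (∫ t : ℝ, 2 * LagariasMontague.Psi (2 * t) * Real.sinh (t / 2) = 0) ∧
    ∀ w : ℝ → ℂ, IsWeilTest w →
      Integrable (fun h : ℝ => Real.cosh (h / 2) *
        ∫ t : ℝ, 2 * LagariasMontague.Psi (2 * t) * (2 * LagariasMontague.Psi (2 * (t + h))) *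
          ‖w (t + h) - w t‖ ^ 2) ∧
      weilPoleForm (fun t : ℝ => (2 : ℂ) * LagariasMontague.Psic (2 * t) * w t) -
          ∫ x : ℝ, 2 * LagariasMontague.Psi (2 * x) * ‖w x‖ ^ 2 * Real.cosh (x / 2) =
        -(∫ h in Ioi (0 : ℝ), 2 * Real.cosh (h / 2) *
          ∫ t : ℝ, 2 * LagariasMontague.Psi (2 * t) * (2 * LagariasMontague.Psi (2 * (t + h))) *
            ‖w (t + h) - w t‖ ^ 2) := by
  refine ⟨doobPol_moments.1, doobPol_moments.2, fun w hw => ?_⟩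
  obtain ⟨K, hK0, hKb⟩ := doobP_exists_bound
  have hφc : Continuous fun t : ℝ => 2 * LagariasMontague.Psi (2 * t) :=
    continuous_const.mul ((LagariasMontague.continuous_thetaSeries _).comp
      (continuous_const.mul continuous_id))
  have hfun : (fun t : ℝ => (2 : ℂ) * LagariasMontague.Psic (2 * t) * w t) =
      fun t : ℝ => ((2 * LagariasMontague.Psi (2 * t) : ℝ) : ℂ) * w t :=
    funext fun t => by rw [doobP_phic]
  have huT : IsWeilTest (fun t : ℝ => ((2 * LagariasMontague.Psi (2 * t) : ℝ) : ℂ) * w t) :=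
    hfun ▸ ⟨contDiff_phi.mul hw.1, hw.2.mul_left⟩
  have main := doobPol_main hφc hK0 hKb doobPol_moments.1 doobPol_moments.2 hw huT (fun t => rfl)
  beta_reduce at main
  rw [hfun]
  refine ⟨main.1, ?_⟩
  rw [main.2]
  ring

end Summit.RiemannHypothesis.RiemannHypothesis.Theorems.GroundStatesConvergeToXi

end
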